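import Summits.CriticalPhenomena.PercolationContinuityZ3.Theses.PercNearOneGluing
import Literature.Probability.Percolation.PercolationEvents
import HarnessLib.Audit
import Literature.Probability.LatticeModels.ProdBernoulliIndependence
import Summits.CriticalPhenomena.PercolationContinuityZ3.Theorems.PercNearOneGluingAdditiveGluingOneBond
import Summits.CriticalPhenomena.PercolationContinuityZ3.Theorems.PercNearOneGluingAdditiveGluingKnLemma3Mixed
import Summits.CriticalPhenomena.PercolationContinuityZ3.Theorems.PercNearOneGluingNearOneGluingPivotalityDomination

/-! TTRL-lite variant V2415 of stmt-CriticalPhenomena-4574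

(`stub_shorteningStep` of line `kn_shortening_induction`, move `small_case`: `A.card ≤ 2`).
Kozma–Nitzan's SHORTENING STEP (arXiv:2401.12397, Conjecture 6, p. 34) against the OLD minimiser
`a₀`, for at most two relays — i.e. the `|A| ≤ 2` case of Conjecture 6, proved outright (the displayed
induction hypothesis is not used).

Write `μ = prodBernoulli w`, `μ₁ = prodBernoulli (w[s(v,x) ↦ 1])`, `V = {v, x}`,
`{V ↔ z} = {v ↔ z} ∪ {x ↔ z}`, and let `a₁` be a relay with `A ⊆ {a₀, a₁}`.
* Transport.  `μ₁` is the image of `μ` under `ω ↦ insert s(v,x) ω`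
  (`goodStepEI_prodBernoulli_map_insert`), and an open path of `insert s(v,x) ω` either avoids the
  new pair or uses it once (`pivDom_reachable_insert`).  Hence `μ₁(v ↔ A) ≤ μ(E)` with
  `E = {V ↔ a₀} ∪ {V ↔ a₁}`, `μ₁(a₀ ↔ b) ≤ μ(K)` with
  `K = {a₀ ↔ b} ∪ ({a₀ ↔ v} ∩ {x ↔ b}) ∪ ({a₀ ↔ x} ∩ {v ↔ b})`, and `μ(V ↔ b) ≤ μ₁(v ↔ b)`.
* Harris (`prodBernoulli_harris`): `μ(E) μ(K) ≤ μ(E ∩ K)`.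
* Event algebra: `E ∩ K ⊆ ({V ↔ b} ∩ {a₀ ↔ V}) ∪ ({a₀ ↔ b} ∩ Q)` with the set-observer event
  `Q = {V ↔ a₁} ∩ {V ↮ a₀}`, and `{V ↔ b} ∩ Q ⊆ {V ↔ b} ∖ {a₀ ↔ V}`.
* Kozma–Nitzan Lemma 3 for the MIXED-monotone event `Q` (increasing in the cluster of `a₁`,
  decreasing in the cluster of `a₀`; `knLemma3Mixed_setObserver_star`, from
  van den Berg–Häggström–Kahn 2006 Thm 1.5), fed by the minimiser hypothesis
  `μ(a₀ ↔ b) ≤ μ(a₁ ↔ b)`: `μ({a₀ ↔ b} ∩ Q) ≤ μ({V ↔ b} ∩ Q)`.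
Adding up, `μ₁(v ↔ A) μ₁(a₀ ↔ b) ≤ μ(E ∩ K) ≤ μ({V ↔ b} ∩ {a₀ ↔ V}) + μ({V ↔ b} ∖ {a₀ ↔ V})
= μ(V ↔ b) ≤ μ₁(v ↔ b)`.  No new definitions, no named facts. -/

namespace Summit.CriticalPhenomena.PercolationContinuityZ3.Theorems

open MeasureTheory Set Literature.Probability.LatticeModels Literature.Probability.Percolation
open scoped Classical BigOperators

/-- TTRL-lite variant V2415 of `stub_shorteningStep` (stmt-CriticalPhenomena-4574): Kozma–Nitzan's
shortening step (Conjecture 6 of arXiv:2401.12397, measured against the minimiser `a₀` of the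
uncontracted graph) for relay sets with `A.card ≤ 2`.  Proof: transport the three glued
probabilities to the uncontracted measure along `ω ↦ insert s(v,x) ω`, Harris, and Kozma–Nitzan
Lemma 3 for the mixed-monotone set-observer event `{V ↔ a₁} ∩ {V ↮ a₀}`, `V = {v, x}`
(`knLemma3Mixed_setObserver_star`), applied with the minimiser hypothesis `P(a₀ ↔ b) ≤ P(a₁ ↔ b)`. -/
theorem stub_shorteningStep_var2415 : ∀ (n : ℕ) (w : Sym2 (Fin n) → unitInterval) (A : Finset (Fin n)) (b v x a₀ : Fin n), A.card ≤ 2 → v ∉ A → v ≠ x → w s(v, x) = 0 → a₀ ∈ A → (∀ a ∈ A, (prodBernoulli w).real (openConn a₀ b) ≤ (prodBernoulli w).real (openConn a b)) → (∀ w' : Sym2 (Fin n) → unitInterval, (∀ e, w e = 0 → w' e = 0) → ∀ (A' : Finset (Fin n)) (o' b' : Fin n) (t : ℝ), (∀ a ∈ A', t ≤ (prodBernoulli w').real (openConn a b')) → (prodBernoulli w').real (⋃ a ∈ A', openConn o' a) * t ≤ (prodBernoulli w').real (openConn o' b')) → (prodBernoulli (Function.update w s(v, x) 1)).real (⋃ a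 ∈ A, openConn v a) * (prodBernoulli (Function.update w s(v, x) 1)).real (openConn a₀ b) ≤ (prodBernoulli (Function.update w s(v, x) 1)).real (openConn v b) := by
  intro n w A b v x a₀ hcard _hvA hvx _hw0 ha₀ hmin _hIH
  -- a second relay `a₁ ∈ A` with `A ⊆ {a₀, a₁}` (possibly `a₁ = a₀`)
  obtain ⟨a₁, ha₁, hA⟩ : ∃ a₁ ∈ A, ∀ a ∈ A, a = a₀ ∨ a = a₁ := by
    by_cases h : ∃ a ∈ A, a ≠ a₀
    · obtain ⟨a₁, ha₁, hne⟩ := h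
      refine ⟨a₁, ha₁, fun a ha => ?_⟩
      by_contra hcon
      push Not at hcon
      have h3 : 2 < A.card :=
        Finset.two_lt_card.2 ⟨a₀, ha₀, a₁, ha₁, a, ha, hne.symm, fun h => hcon.1 h.symm,
          fun h => hcon.2 h.symm⟩
      omega
    · push Not at h
      exact ⟨a₀, ha₀, fun a ha => Or.inl (h a ha)⟩
  -- every event is measurable on the finite configuration space
  have hmeas : ∀ S : Set (BondConfig (Fin n)), MeasurableSet S := fun S =>
    MeasurableSet.of_discrete
  -- transport along `ω ↦ insert s(v,x) ω`, whose image measure is the glued measure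
  have hmi : Measurable fun ω : BondConfig (Fin n) => insert s(v, x) ω := by
    refine measurable_set_iff.2 fun i => ?_
    simp only [Set.mem_insert_iff]
    exact measurable_const.or (measurable_set_mem i)
  have htrans : ∀ F : Set (BondConfig (Fin n)),
      (prodBernoulli (Function.update w s(v, x) 1)).real F =
        (prodBernoulli w).real ((fun ω : BondConfig (Fin n) => insert s(v, x) ω) ⁻¹' F) := by
    intro F
    rw [← goodStepEI_prodBernoulli_map_insert w s(v, x), map_measureReal_apply hmi (hmeas F)]
  -- the events of the uncontracted graph (`V = {v, x}`)
  set Fb : Set (BondConfig (Fin n)) := openConn v b ∪ openConn x b with hFb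
  set E : Set (BondConfig (Fin n)) :=
    (openConn v a₀ ∪ openConn x a₀) ∪ (openConn v a₁ ∪ openConn x a₁) with hE
  set K : Set (BondConfig (Fin n)) :=
    openConn a₀ b ∪ ((openConn a₀ v ∩ openConn x b) ∪ (openConn a₀ x ∩ openConn v b)) with hK
  set T : Set (BondConfig (Fin n)) := openConn a₀ v ∪ openConn a₀ x with hT
  set Q : Set (BondConfig (Fin n)) :=
    {ω | (∃ y ∈ ({v, x} : Finset (Fin n)), (openGraph ω).Reachable a₁ y) ∧
      ∀ y ∈ ({v, x} : Finset (Fin n)), ¬ (openGraph ω).Reachable a₀ y} with hQ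
  set Sb : Set (BondConfig (Fin n)) :=
    {ω | ∃ y ∈ ({v, x} : Finset (Fin n)), (openGraph ω).Reachable y b} with hSb
  -- (1) the three transports
  have hX : (prodBernoulli w).real Fb ≤
      (prodBernoulli (Function.update w s(v, x) 1)).real (openConn v b) := by
    rw [htrans]
    refine measureReal_mono (fun ω hω => ?_)
    rcases hω with h | h
    · exact (h : (openGraph ω).Reachable v b).mono (openGraph_mono (Set.subset_insert _ _))
    · exact pivDom_reachable_insert_of ω hvx h
  have hY : (prodBernoulli (Function.update w s(v, x) 1)).real (⋃ a ∈ A, openConn v a) ≤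
      (prodBernoulli w).real E := by
    rw [htrans]
    refine measureReal_mono (fun ω hω => ?_)
    simp only [Set.mem_preimage, Set.mem_iUnion, exists_prop] at hω
    obtain ⟨a, ha, h⟩ := hω
    have h' : (openGraph ω).Reachable v a ∨ (openGraph ω).Reachable x a := by
      rcases pivDom_reachable_insert ω v x v a h with h1 | ⟨-, h1⟩ | ⟨-, h1⟩
      exacts [Or.inl h1, Or.inr h1, Or.inl h1]
    rcases hA a ha with h0 | h0
    · rw [h0] at h'
      exact Or.inl h'
    · rw [h0] at h'
      exact Or.inr h'
  have hZ : (prodBernoulli (Function.update w s(v, x) 1)).real (openConn a₀ b) ≤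
      (prodBernoulli w).real K := by
    rw [htrans]
    refine measureReal_mono (fun ω hω => ?_)
    rcases pivDom_reachable_insert ω v x a₀ b hω with h1 | ⟨h1, h2⟩ | ⟨h1, h2⟩
    exacts [Or.inl h1, Or.inr (Or.inl ⟨h1, h2⟩), Or.inr (Or.inr ⟨h1, h2⟩)]
  -- (2) Harris for the increasing events `E`, `K`
  have hEup : IsUpperSet E :=
    ((isUpperSet_openConn v a₀).union (isUpperSet_openConn x a₀)).union
      ((isUpperSet_openConn v a₁).union (isUpperSet_openConn x a₁))
  have hKup : IsUpperSet K :=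
    (isUpperSet_openConn a₀ b).union
      (((isUpperSet_openConn a₀ v).inter (isUpperSet_openConn x b)).union
        ((isUpperSet_openConn a₀ x).inter (isUpperSet_openConn v b)))
  have hHarris : (prodBernoulli w).real E * (prodBernoulli w).real K ≤
      (prodBernoulli w).real (E ∩ K) :=
    prodBernoulli_harris w hEup hKup (hmeas _) (hmeas _)
  -- (3) event algebra
  have hsplit : E ∩ K ⊆ (Fb ∩ T) ∪ (openConn a₀ b ∩ Q) := by
    rintro ω ⟨hωE, hωK⟩
    by_cases hT' : ω ∈ T
    · left
      refine ⟨?_, hT'⟩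
      rcases hωK with hab | ⟨_, hxb⟩ | ⟨_, hvb⟩
      · rcases hT' with hav | hax
        · exact Or.inl ((SimpleGraph.Reachable.symm hav).trans hab)
        · exact Or.inr ((SimpleGraph.Reachable.symm hax).trans hab)
      · exact Or.inr hxb
      · exact Or.inl hvb
    · right
      have hav : ¬ (openGraph ω).Reachable a₀ v := fun h => hT' (Or.inl h)
      have hax : ¬ (openGraph ω).Reachable a₀ x := fun h => hT' (Or.inr h)
      refine ⟨?_, ?_, ?_⟩
      · rcases hωK with hab | ⟨h, _⟩ | ⟨h, _⟩
        exacts [hab, absurd h hav, absurd h hax]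
      · rcases hωE with (h | h) | (h | h)
        · exact absurd (SimpleGraph.Reachable.symm h) hav
        · exact absurd (SimpleGraph.Reachable.symm h) hax
        · exact ⟨v, by simp, SimpleGraph.Reachable.symm h⟩
        · exact ⟨x, by simp, SimpleGraph.Reachable.symm h⟩
      · intro y hy
        simp only [Finset.mem_insert, Finset.mem_singleton] at hy
        rcases hy with hy | hy
        · rw [hy]; exact hav
        · rw [hy]; exact hax
  have hSbQ : Sb ∩ Q ⊆ Fb \ T := by
    rintro ω ⟨⟨y, hy, hyb⟩, -, hno⟩
    refine ⟨?_, ?_⟩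
    · simp only [Finset.mem_insert, Finset.mem_singleton] at hy
      rcases hy with hy | hy
      · rw [hy] at hyb; exact Or.inl hyb
      · rw [hy] at hyb; exact Or.inr hyb
    · rintro (h | h)
      · exact hno v (by simp) h
      · exact hno x (by simp) h
  -- (4) Kozma–Nitzan Lemma 3 (mixed, set observer `{v, x}`), fed by the minimiser hypothesis
  have hL3 : (prodBernoulli w).real (openConn a₀ b ∩ Q) ≤ (prodBernoulli w).real (Sb ∩ Q) + 0 :=
    knLemma3Mixed_setObserver_star n w a₀ a₁ b ({v, x} : Finset (Fin n)) 0 le_rfl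
      (by rw [add_zero]; exact hmin a₁ ha₁)
  -- (5) assemble
  have hFsum : (prodBernoulli w).real (Fb ∩ T) + (prodBernoulli w).real (Fb \ T) =
      (prodBernoulli w).real Fb :=
    measureReal_inter_add_sdiff (hmeas T)
  have h1 : (prodBernoulli w).real (E ∩ K) ≤
      (prodBernoulli w).real (Fb ∩ T) + (prodBernoulli w).real (openConn a₀ b ∩ Q) :=
    (measureReal_mono hsplit).trans (measureReal_union_le _ _)
  have h2 : (prodBernoulli w).real (Sb ∩ Q) ≤ (prodBernoulli w).real (Fb \ T) :=
    measureReal_mono hSbQ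
  calc (prodBernoulli (Function.update w s(v, x) 1)).real (⋃ a ∈ A, openConn v a) *
        (prodBernoulli (Function.update w s(v, x) 1)).real (openConn a₀ b)
      ≤ (prodBernoulli w).real E * (prodBernoulli w).real K :=
        mul_le_mul hY hZ measureReal_nonneg measureReal_nonneg
    _ ≤ (prodBernoulli w).real (E ∩ K) := hHarris
    _ ≤ (prodBernoulli w).real Fb := by linarith
    _ ≤ (prodBernoulli (Function.update w s(v, x) 1)).real (openConn v b) := hX

end Summit.CriticalPhenomena.PercolationContinuityZ3.Theorems
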